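import Mathlib
import HarnessLib
import Summits.NavierStokesRegularity.NavierStokesRegularity.Theorems.LrcModEntire.Negative.TwistedColumnWindow
import Summits.NavierStokesRegularity.NavierStokesRegularity.Theorems.LrcModEntire.Negative.TwistedColumnGerms

/-!
# Item `LrcModEntire` (stmt-NavierStokesRegularity-20428) — negative side: `stub_twistingTH` and the twisting germ step
# of skeleton twist-split v3 are FALSE without the Oseen-mild identity (M), even granted (F) + (A)

Negative-side support (refuter seat ns-regularity-refuter1, K-47; D-0081 §C).  Skeleton twist-split v3
(`Cruxes/LrcModEntire/Lines/twist_split.lean`, sha16 acd3fa31ab2c2c0a) reduces the item to `stub_untwistedGerm` (landed) and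
the twisting germ step `twistingGerm_of_stubs`, split into `stub_twistingTH` (the shear slope IS a function of `(t, x₂)` on
the window) and `stub_twistingThick`.  The TWISTED (TH) COLUMN `twistProfile` (`…Negative.TwistedColumnODE/Field/…/Germs`)
satisfies every hypothesis of `stub_twistingTH` except (M) — Type-I rate `C = 10`, continuity, divergence-free, poloidal,
the three pins, the slope clause (slope strictly increasing in `x₂`), twist bracket `−(−t)^{-1} sin x₀ sin x₁ ≠ 0`, and
the (TH) identity `∂₂v_b = m(x₂) ∂_b v₂` with `m = twistSlope` — and moreover (F) the frozen constraint and (A) entire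
real-analytic slices; yet NO slice carries a translation / rotation / unbounded-entire germ on any window.  Hence:
`twistingTH_false_without_mild`, `twistingTH_false_without_mild_frozen_analytic`, and the same for the parent germ step
(`twistingGerm_false_without_mild[_frozen_analytic]`).  READING for the leads (K2-p2 RESULT B TH-STEP3, nsreg-p7
Riquier–Janet, cert-1): the purely kinematic system «(TH) ∧ m_z ≠ 0 ∧ ND ∧ twisting ∧ frozen ∧ poloidal ∧ div-free ∧
analytic» HAS bounded entire solutions — any finite-jet certificate closing `stub_twistingTH` must use the momentum
equation (M); the explicit jet of `twistProfile` is the test case.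
WHAT THIS IS NOT: not a claim about Navier–Stokes regularity and not a refutation of the item — (M) is deleted. [folklore]
-/

noncomputable section

-- the summit and its single sub-problem share the name (CONVENTIONS §1), as in every Theorems file
set_option linter.dupNamespace false

namespace Summit.NavierStokesRegularity.NavierStokesRegularity.Theorems.LrcModEntire.Negative

open MeasureTheory Set Function Filter Topology Metric
open scoped RealInnerProductSpace InnerProductSpace
open Literature.Analysis Literature.Analysis.FluidPDE
open Summit.NavierStokesRegularity.NavierStokesRegularity.Theorems.PoloidalWindowRigidity.Negative

local notation "E3" => EuclideanSpace ℝ (Fin 3)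
local notation "𝐞" i => (EuclideanSpace.single (i : Fin 3) (1 : ℝ) : EuclideanSpace ℝ (Fin 3))

/-- The germ trichotomy fails for every slice of the twisted column on every window. [folklore] -/
theorem twistProfile_no_germ {s : ℝ} (hs : s < 0) {U : Set E3} (hU : IsOpen U) (hne : U.Nonempty) :
    ¬ ((∃ e : E3, e ≠ 0 ∧ ∀ y ∈ U, fderiv ℝ (curl (twistProfile s)) y e = 0) ∨
       (∃ c : E3, ∀ y ∈ U, rotGen (curl (twistProfile s) y) = fderiv ℝ (curl (twistProfile s)) y (rotGen (y - c))) ∨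
       (∃ w : E3 → E3, AnalyticOnNhd ℝ w Set.univ ∧ ¬ BddAbove (Set.range fun y => ‖w y‖) ∧
          ∀ y ∈ U, twistProfile s y = w y)) := by
  rintro (⟨e, he, htr⟩ | ⟨c, hrot⟩ | ⟨w, hw, hunb, hwU⟩)
  · exact twistProfile_no_translation_germ hs hU hne he htr
  · exact twistProfile_no_rotation_germ hs hU hne c hrot
  · exact hunb (twistProfile_no_unbounded_entire_germ s hU hne hw hwU)

/-- **`stub_twistingTH` of skeleton twist-split v3 is FALSE without the Oseen-mild identity (M).**  The hypotheses are those
of `stub_twistingTH` VERBATIM with (M) deleted; the twisted (TH) column (`C = 10`, window `twistWindow`, time–height slope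
`m(t, h) = twistSlope h`) satisfies all of them, and no slice has a germ of any of the three kinds. [folklore] -/
theorem twistingTH_false_without_mild :
    ¬ (∀ (C : ℝ) (v : ℝ → EuclideanSpace ℝ (Fin 3) → EuclideanSpace ℝ (Fin 3)),
      Literature.Analysis.FluidPDE.HasTypeITimeDecay C v →
      ContinuousOn (Function.uncurry v) (Set.Iio (0 : ℝ) ×ˢ Set.univ) →
      (∀ t < 0, Literature.Analysis.FluidPDE.VectorCalculus.IsDivFree (v t)) →
      (∀ s < 0, ∀ y, ⟪Literature.Analysis.FluidPDE.curl (v s) y, EuclideanSpace.single 2 1⟫_ℝ = 0) →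
      ∀ W : Set (ℝ × EuclideanSpace ℝ (Fin 3)), IsOpen W → W.Nonempty → W ⊆ Set.Iio (0 : ℝ) ×ˢ Set.univ →
        (∀ z ∈ W, Literature.Analysis.FluidPDE.curl (v z.1) z.2 ≠ 0 ∧
          (fderiv ℝ (v z.1) z.2 (EuclideanSpace.single 0 1) 2 ≠ 0 ∨ fderiv ℝ (v z.1) z.2 (EuclideanSpace.single 1 1) 2 ≠ 0) ∧
          (fderiv ℝ (v z.1) z.2 (EuclideanSpace.single 2 1) 0 ≠ 0 ∨ fderiv ℝ (v z.1) z.2 (EuclideanSpace.single 2 1) 1 ≠ 0)) →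
        (∀ m : ℝ → ℝ, ∀ W₁ : Set (ℝ × EuclideanSpace ℝ (Fin 3)), W₁ ⊆ W → IsOpen W₁ → W₁.Nonempty →
          ∃ z ∈ W₁, ∃ b : Fin 3, b ≠ 2 ∧
            fderiv ℝ (v z.1) z.2 (EuclideanSpace.single 2 1) b ≠
              m z.1 * fderiv ℝ (v z.1) z.2 (EuclideanSpace.single b 1) 2) →
        (∀ z ∈ W,
          fderiv ℝ (fun x => fderiv ℝ (v z.1) x (EuclideanSpace.single 2 1) 2) z.2 (EuclideanSpace.single 0 1) *
              fderiv ℝ (v z.1) z.2 (EuclideanSpace.single 1 1) 2 -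
            fderiv ℝ (fun x => fderiv ℝ (v z.1) x (EuclideanSpace.single 2 1) 2) z.2 (EuclideanSpace.single 1 1) *
              fderiv ℝ (v z.1) z.2 (EuclideanSpace.single 0 1) 2 ≠ 0) →
        (∃ m : ℝ → ℝ → ℝ, ∀ z ∈ W, ∀ b : Fin 3, b ≠ 2 →
          fderiv ℝ (v z.1) z.2 (EuclideanSpace.single 2 1) b =
            m z.1 (z.2 2) * fderiv ℝ (v z.1) z.2 (EuclideanSpace.single b 1) 2) →
        ∃ s : ℝ, s < 0 ∧ ∃ U : Set (EuclideanSpace ℝ (Fin 3)), IsOpen U ∧ U.Nonempty ∧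
          ((∃ e : EuclideanSpace ℝ (Fin 3), e ≠ 0 ∧
              ∀ y ∈ U, fderiv ℝ (Literature.Analysis.FluidPDE.curl (v s)) y e = 0) ∨
           (∃ c : EuclideanSpace ℝ (Fin 3), ∀ y ∈ U,
              Literature.Analysis.FluidPDE.rotGen (Literature.Analysis.FluidPDE.curl (v s) y) =
                fderiv ℝ (Literature.Analysis.FluidPDE.curl (v s)) y (Literature.Analysis.FluidPDE.rotGen (y - c))) ∨
           (∃ w : EuclideanSpace ℝ (Fin 3) → EuclideanSpace ℝ (Fin 3), AnalyticOnNhd ℝ w Set.univ ∧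
              ¬ BddAbove (Set.range fun y => ‖w y‖) ∧ ∀ y ∈ U, v s y = w y))) := by
  intro H
  obtain ⟨s, hs, U, hU, hne, halt⟩ := H 10 twistProfile hasTypeITimeDecay_twistProfile continuousOn_twistProfile
    (fun t _ => isDivFree_twistProfile t) (fun s _ y => poloidal_twistProfile s y) twistWindow isOpen_twistWindow
    twistWindow_nonempty twistWindow_subset twistProfile_pins
    (fun m W₁ hW₁ hW₁o hW₁n => twistProfile_slope_not_time_only m W₁ hW₁ hW₁o hW₁n)
    twistProfile_twist_ne_zero ⟨fun _ h => twistSlope h, fun z _ b hb => twistProfile_timeHeightSlope z b hb⟩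
  exact twistProfile_no_germ hs hU hne halt

/-- **The same, EVEN GRANTED the frozen Clebsch structure and real-analytic slices** ((M) REPLACED by (F) the frozen
constraint `⟪Dv(s)(y)·curl v(s)(y), e₂⟫ = 0` and (A) real-analyticity of every slice, both consequences of (M) in the
class): still false on the same witness (`frozen_twistProfile`, `analyticOnNhd_twistProfile`).  So the kinematic (TH) system
is NOT empty on the twisting stratum: (M) itself must enter any certificate for `stub_twistingTH`. [folklore] -/
theorem twistingTH_false_without_mild_frozen_analytic :
    ¬ (∀ (C : ℝ) (v : ℝ → EuclideanSpace ℝ (Fin 3) → EuclideanSpace ℝ (Fin 3)),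
      Literature.Analysis.FluidPDE.HasTypeITimeDecay C v →
      ContinuousOn (Function.uncurry v) (Set.Iio (0 : ℝ) ×ˢ Set.univ) →
      (∀ t < 0, Literature.Analysis.FluidPDE.VectorCalculus.IsDivFree (v t)) →
      (∀ s < 0, ∀ y, ⟪Literature.Analysis.FluidPDE.curl (v s) y, EuclideanSpace.single 2 1⟫_ℝ = 0) →
      (∀ s < 0, ∀ y, ⟪fderiv ℝ (v s) y (Literature.Analysis.FluidPDE.curl (v s) y), EuclideanSpace.single 2 1⟫_ℝ = 0) →
      (∀ s < 0, AnalyticOnNhd ℝ (v s) Set.univ) →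
      ∀ W : Set (ℝ × EuclideanSpace ℝ (Fin 3)), IsOpen W → W.Nonempty → W ⊆ Set.Iio (0 : ℝ) ×ˢ Set.univ →
        (∀ z ∈ W, Literature.Analysis.FluidPDE.curl (v z.1) z.2 ≠ 0 ∧
          (fderiv ℝ (v z.1) z.2 (EuclideanSpace.single 0 1) 2 ≠ 0 ∨ fderiv ℝ (v z.1) z.2 (EuclideanSpace.single 1 1) 2 ≠ 0) ∧
          (fderiv ℝ (v z.1) z.2 (EuclideanSpace.single 2 1) 0 ≠ 0 ∨ fderiv ℝ (v z.1) z.2 (EuclideanSpace.single 2 1) 1 ≠ 0)) →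
        (∀ m : ℝ → ℝ, ∀ W₁ : Set (ℝ × EuclideanSpace ℝ (Fin 3)), W₁ ⊆ W → IsOpen W₁ → W₁.Nonempty →
          ∃ z ∈ W₁, ∃ b : Fin 3, b ≠ 2 ∧
            fderiv ℝ (v z.1) z.2 (EuclideanSpace.single 2 1) b ≠
              m z.1 * fderiv ℝ (v z.1) z.2 (EuclideanSpace.single b 1) 2) →
        (∀ z ∈ W,
          fderiv ℝ (fun x => fderiv ℝ (v z.1) x (EuclideanSpace.single 2 1) 2) z.2 (EuclideanSpace.single 0 1) *
              fderiv ℝ (v z.1) z.2 (EuclideanSpace.single 1 1) 2 -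
            fderiv ℝ (fun x => fderiv ℝ (v z.1) x (EuclideanSpace.single 2 1) 2) z.2 (EuclideanSpace.single 1 1) *
              fderiv ℝ (v z.1) z.2 (EuclideanSpace.single 0 1) 2 ≠ 0) →
        (∃ m : ℝ → ℝ → ℝ, ∀ z ∈ W, ∀ b : Fin 3, b ≠ 2 →
          fderiv ℝ (v z.1) z.2 (EuclideanSpace.single 2 1) b =
            m z.1 (z.2 2) * fderiv ℝ (v z.1) z.2 (EuclideanSpace.single b 1) 2) →
        ∃ s : ℝ, s < 0 ∧ ∃ U : Set (EuclideanSpace ℝ (Fin 3)), IsOpen U ∧ U.Nonempty ∧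
          ((∃ e : EuclideanSpace ℝ (Fin 3), e ≠ 0 ∧
              ∀ y ∈ U, fderiv ℝ (Literature.Analysis.FluidPDE.curl (v s)) y e = 0) ∨
           (∃ c : EuclideanSpace ℝ (Fin 3), ∀ y ∈ U,
              Literature.Analysis.FluidPDE.rotGen (Literature.Analysis.FluidPDE.curl (v s) y) =
                fderiv ℝ (Literature.Analysis.FluidPDE.curl (v s)) y (Literature.Analysis.FluidPDE.rotGen (y - c))) ∨
           (∃ w : EuclideanSpace ℝ (Fin 3) → EuclideanSpace ℝ (Fin 3), AnalyticOnNhd ℝ w Set.univ ∧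
              ¬ BddAbove (Set.range fun y => ‖w y‖) ∧ ∀ y ∈ U, v s y = w y))) := by
  intro H
  obtain ⟨s, hs, U, hU, hne, halt⟩ := H 10 twistProfile hasTypeITimeDecay_twistProfile continuousOn_twistProfile
    (fun t _ => isDivFree_twistProfile t) (fun s _ y => poloidal_twistProfile s y)
    (fun s _ y => frozen_twistProfile s y) (fun s _ => analyticOnNhd_twistProfile s) twistWindow isOpen_twistWindow
    twistWindow_nonempty twistWindow_subset twistProfile_pins
    (fun m W₁ hW₁ hW₁o hW₁n => twistProfile_slope_not_time_only m W₁ hW₁ hW₁o hW₁n)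
    twistProfile_twist_ne_zero ⟨fun _ h => twistSlope h, fun z _ b hb => twistProfile_timeHeightSlope z b hb⟩
  exact twistProfile_no_germ hs hU hne halt

/-- **The parent germ step `twistingGerm_of_stubs` (= `stub_twistingTH` ∧ `stub_twistingThick`) is FALSE without (M)** —
immediate from the (TH) case. [folklore] -/
theorem twistingGerm_false_without_mild :
    ¬ (∀ (C : ℝ) (v : ℝ → EuclideanSpace ℝ (Fin 3) → EuclideanSpace ℝ (Fin 3)),
      Literature.Analysis.FluidPDE.HasTypeITimeDecay C v →
      ContinuousOn (Function.uncurry v) (Set.Iio (0 : ℝ) ×ˢ Set.univ) →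
      (∀ t < 0, Literature.Analysis.FluidPDE.VectorCalculus.IsDivFree (v t)) →
      (∀ s < 0, ∀ y, ⟪Literature.Analysis.FluidPDE.curl (v s) y, EuclideanSpace.single 2 1⟫_ℝ = 0) →
      ∀ W : Set (ℝ × EuclideanSpace ℝ (Fin 3)), IsOpen W → W.Nonempty → W ⊆ Set.Iio (0 : ℝ) ×ˢ Set.univ →
        (∀ z ∈ W, Literature.Analysis.FluidPDE.curl (v z.1) z.2 ≠ 0 ∧
          (fderiv ℝ (v z.1) z.2 (EuclideanSpace.single 0 1) 2 ≠ 0 ∨ fderiv ℝ (v z.1) z.2 (EuclideanSpace.single 1 1) 2 ≠ 0) ∧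
          (fderiv ℝ (v z.1) z.2 (EuclideanSpace.single 2 1) 0 ≠ 0 ∨ fderiv ℝ (v z.1) z.2 (EuclideanSpace.single 2 1) 1 ≠ 0)) →
        (∀ m : ℝ → ℝ, ∀ W₁ : Set (ℝ × EuclideanSpace ℝ (Fin 3)), W₁ ⊆ W → IsOpen W₁ → W₁.Nonempty →
          ∃ z ∈ W₁, ∃ b : Fin 3, b ≠ 2 ∧
            fderiv ℝ (v z.1) z.2 (EuclideanSpace.single 2 1) b ≠
              m z.1 * fderiv ℝ (v z.1) z.2 (EuclideanSpace.single b 1) 2) →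
        (∀ z ∈ W,
          fderiv ℝ (fun x => fderiv ℝ (v z.1) x (EuclideanSpace.single 2 1) 2) z.2 (EuclideanSpace.single 0 1) *
              fderiv ℝ (v z.1) z.2 (EuclideanSpace.single 1 1) 2 -
            fderiv ℝ (fun x => fderiv ℝ (v z.1) x (EuclideanSpace.single 2 1) 2) z.2 (EuclideanSpace.single 1 1) *
              fderiv ℝ (v z.1) z.2 (EuclideanSpace.single 0 1) 2 ≠ 0) →
        ∃ s : ℝ, s < 0 ∧ ∃ U : Set (EuclideanSpace ℝ (Fin 3)), IsOpen U ∧ U.Nonempty ∧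
          ((∃ e : EuclideanSpace ℝ (Fin 3), e ≠ 0 ∧
              ∀ y ∈ U, fderiv ℝ (Literature.Analysis.FluidPDE.curl (v s)) y e = 0) ∨
           (∃ c : EuclideanSpace ℝ (Fin 3), ∀ y ∈ U,
              Literature.Analysis.FluidPDE.rotGen (Literature.Analysis.FluidPDE.curl (v s) y) =
                fderiv ℝ (Literature.Analysis.FluidPDE.curl (v s)) y (Literature.Analysis.FluidPDE.rotGen (y - c))) ∨
           (∃ w : EuclideanSpace ℝ (Fin 3) → EuclideanSpace ℝ (Fin 3), AnalyticOnNhd ℝ w Set.univ ∧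
              ¬ BddAbove (Set.range fun y => ‖w y‖) ∧ ∀ y ∈ U, v s y = w y))) := by
  intro H
  obtain ⟨s, hs, U, hU, hne, halt⟩ := H 10 twistProfile hasTypeITimeDecay_twistProfile continuousOn_twistProfile
    (fun t _ => isDivFree_twistProfile t) (fun s _ y => poloidal_twistProfile s y) twistWindow isOpen_twistWindow
    twistWindow_nonempty twistWindow_subset twistProfile_pins
    (fun m W₁ hW₁ hW₁o hW₁n => twistProfile_slope_not_time_only m W₁ hW₁ hW₁o hW₁n)
    twistProfile_twist_ne_zero
  exact twistProfile_no_germ hs hU hne halt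

/-- **… and FALSE with (M) replaced by (F) + (A).** [folklore] -/
theorem twistingGerm_false_without_mild_frozen_analytic :
    ¬ (∀ (C : ℝ) (v : ℝ → EuclideanSpace ℝ (Fin 3) → EuclideanSpace ℝ (Fin 3)),
      Literature.Analysis.FluidPDE.HasTypeITimeDecay C v →
      ContinuousOn (Function.uncurry v) (Set.Iio (0 : ℝ) ×ˢ Set.univ) →
      (∀ t < 0, Literature.Analysis.FluidPDE.VectorCalculus.IsDivFree (v t)) →
      (∀ s < 0, ∀ y, ⟪Literature.Analysis.FluidPDE.curl (v s) y, EuclideanSpace.single 2 1⟫_ℝ = 0) →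
      (∀ s < 0, ∀ y, ⟪fderiv ℝ (v s) y (Literature.Analysis.FluidPDE.curl (v s) y), EuclideanSpace.single 2 1⟫_ℝ = 0) →
      (∀ s < 0, AnalyticOnNhd ℝ (v s) Set.univ) →
      ∀ W : Set (ℝ × EuclideanSpace ℝ (Fin 3)), IsOpen W → W.Nonempty → W ⊆ Set.Iio (0 : ℝ) ×ˢ Set.univ →
        (∀ z ∈ W, Literature.Analysis.FluidPDE.curl (v z.1) z.2 ≠ 0 ∧
          (fderiv ℝ (v z.1) z.2 (EuclideanSpace.single 0 1) 2 ≠ 0 ∨ fderiv ℝ (v z.1) z.2 (EuclideanSpace.single 1 1) 2 ≠ 0) ∧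
          (fderiv ℝ (v z.1) z.2 (EuclideanSpace.single 2 1) 0 ≠ 0 ∨ fderiv ℝ (v z.1) z.2 (EuclideanSpace.single 2 1) 1 ≠ 0)) →
        (∀ m : ℝ → ℝ, ∀ W₁ : Set (ℝ × EuclideanSpace ℝ (Fin 3)), W₁ ⊆ W → IsOpen W₁ → W₁.Nonempty →
          ∃ z ∈ W₁, ∃ b : Fin 3, b ≠ 2 ∧
            fderiv ℝ (v z.1) z.2 (EuclideanSpace.single 2 1) b ≠
              m z.1 * fderiv ℝ (v z.1) z.2 (EuclideanSpace.single b 1) 2) →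
        (∀ z ∈ W,
          fderiv ℝ (fun x => fderiv ℝ (v z.1) x (EuclideanSpace.single 2 1) 2) z.2 (EuclideanSpace.single 0 1) *
              fderiv ℝ (v z.1) z.2 (EuclideanSpace.single 1 1) 2 -
            fderiv ℝ (fun x => fderiv ℝ (v z.1) x (EuclideanSpace.single 2 1) 2) z.2 (EuclideanSpace.single 1 1) *
              fderiv ℝ (v z.1) z.2 (EuclideanSpace.single 0 1) 2 ≠ 0) →
        ∃ s : ℝ, s < 0 ∧ ∃ U : Set (EuclideanSpace ℝ (Fin 3)), IsOpen U ∧ U.Nonempty ∧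
          ((∃ e : EuclideanSpace ℝ (Fin 3), e ≠ 0 ∧
              ∀ y ∈ U, fderiv ℝ (Literature.Analysis.FluidPDE.curl (v s)) y e = 0) ∨
           (∃ c : EuclideanSpace ℝ (Fin 3), ∀ y ∈ U,
              Literature.Analysis.FluidPDE.rotGen (Literature.Analysis.FluidPDE.curl (v s) y) =
                fderiv ℝ (Literature.Analysis.FluidPDE.curl (v s)) y (Literature.Analysis.FluidPDE.rotGen (y - c))) ∨
           (∃ w : EuclideanSpace ℝ (Fin 3) → EuclideanSpace ℝ (Fin 3), AnalyticOnNhd ℝ w Set.univ ∧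
              ¬ BddAbove (Set.range fun y => ‖w y‖) ∧ ∀ y ∈ U, v s y = w y))) := by
  intro H
  obtain ⟨s, hs, U, hU, hne, halt⟩ := H 10 twistProfile hasTypeITimeDecay_twistProfile continuousOn_twistProfile
    (fun t _ => isDivFree_twistProfile t) (fun s _ y => poloidal_twistProfile s y)
    (fun s _ y => frozen_twistProfile s y) (fun s _ => analyticOnNhd_twistProfile s) twistWindow isOpen_twistWindow
    twistWindow_nonempty twistWindow_subset twistProfile_pins
    (fun m W₁ hW₁ hW₁o hW₁n => twistProfile_slope_not_time_only m W₁ hW₁ hW₁o hW₁n)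
    twistProfile_twist_ne_zero
  exact twistProfile_no_germ hs hU hne halt

end Summit.NavierStokesRegularity.NavierStokesRegularity.Theorems.LrcModEntire.Negative

end
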